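import Mathlib

/-!
# Stub S1 `stub_liftOfFiniteIndex` of line `Sketch` (projective-retract sieve) for crux
`CongruenceShadows.HeegaardPairFreenessDetection` (item stmt-SmoothPoincare4-15157)

**The lifting property passes to finite-index subgroups.**  Say a group `G` has the *lifting
property* if every homomorphism `π : G → P` to a finite group lifts through every surjection of finite
groups `ε : E ↠ P` (`ε ∘ f = π`; the finite shadow of "the profinite completion `Ĝ` is projective").
If `G` has it, so does every subgroup `V ≤ G` of finite index.

Proof (coinduction / Shapiro, at finite level).  Let `X = G ⧸ V` (finite), `s : X → G` a transversal
(`s x ∈ x`) and `d g x = (s x)⁻¹ · g · s(g⁻¹ x) ∈ V` the associated cocycle,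
`d (g h) x = d g x · d h (g⁻¹ x)`.  For a finite group `P` let `W_P = (X → P) ⋊ Sym(X)` be the
permutation wreath product (`Sym(X)` permuting coordinates).  Given `π : V → P`, the induced map
`Φ g = ((x ↦ π (d g x)), g·)` is a homomorphism `G → W_P`; it lifts through the surjection
`W_E ↠ W_P` induced by `ε` to `F : G → W_E`.  On `V` the permutation part fixes the coset `x₀ = V`, so
`v ↦ (F v)(x₀)` is a homomorphism `f₀ : V → E` with `ε (f₀ v) = π (s₀⁻¹ v s₀)`, `s₀ = s x₀ ∈ V`;
precomposing with conjugation by `s₀` gives the lift of `π`.  Finite groups in a higher universe are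
first shrunk into `Type` (`s1_lift_univ`).
-/

noncomputable section

-- the prescribed namespace `Summit.<P>.<Sub>.…` duplicates `SmoothPoincare4` (P = Sub)
set_option linter.dupNamespace false

namespace Summit.SmoothPoincare4.SmoothPoincare4.Theorems.HeegaardPairFreenessDetection.Sieve

open Subgroup

universe u v

/-- The lifting property for finite groups in `Type` gives it for finite groups in every universe
(shrink `P` and `E` into `Type`, `Shrink.mulEquiv`). [folklore] -/
theorem s1_lift_univ {G : Type u} [Group G]
    (hG : ∀ (P E : Type) [Group P] [Finite P] [Group E] [Finite E] (π : G →* P) (ε : E →* P),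
      Function.Surjective ε → ∃ f : G →* E, ε.comp f = π)
    {P E : Type v} [Group P] [Finite P] [Group E] [Finite E] (π : G →* P) (ε : E →* P)
    (hε : Function.Surjective ε) : ∃ f : G →* E, ε.comp f = π := by
  haveI hP : Small.{0} P := inferInstance
  haveI hE : Small.{0} E := inferInstance
  haveI : Finite (Shrink.{0} P) := Finite.of_equiv P (equivShrink P)
  haveI : Finite (Shrink.{0} E) := Finite.of_equiv E (equivShrink E)
  let eP : Shrink.{0} P ≃* P := Shrink.mulEquiv
  let eE : Shrink.{0} E ≃* E := Shrink.mulEquiv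
  obtain ⟨f, hf⟩ := hG (Shrink.{0} P) (Shrink.{0} E) (eP.symm.toMonoidHom.comp π)
    (eP.symm.toMonoidHom.comp (ε.comp eE.toMonoidHom))
    (eP.symm.surjective.comp (hε.comp eE.surjective))
  refine ⟨eE.toMonoidHom.comp f, MonoidHom.ext fun x => eP.symm.injective ?_⟩
  have := DFunLike.congr_fun hf x
  simpa using this

/-- **Transversal cocycle.**  For a subgroup `V ≤ G` there are a coset representative map
`s : G ⧸ V → G` and a map `d : G → G ⧸ V → V` with `(d g x : G) = (s x)⁻¹ * g * s (g⁻¹ • x)`,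
satisfying the cocycle identity `d (g * h) x = d g x * d h (g⁻¹ • x)`, `d 1 x = 1`, and with
`s x₀ ∈ V` for the trivial coset `x₀`. [folklore] -/
theorem s1_exists_cocycle {G : Type u} [Group G] (V : Subgroup G) :
    ∃ (s : G ⧸ V → G) (d : G → G ⧸ V → V),
      (∀ x, (s x : G ⧸ V) = x) ∧
      (∀ g x, ((d g x : V) : G) = (s x)⁻¹ * (g * s (g⁻¹ • x))) ∧
      (∀ g h x, d (g * h) x = d g x * d h (g⁻¹ • x)) ∧
      (∀ x, d 1 x = 1) := by
  classical
  let s : G ⧸ V → G := Quotient.out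
  have hs : ∀ x : G ⧸ V, (s x : G ⧸ V) = x := fun x => QuotientGroup.out_eq' x
  have hmem : ∀ (g : G) (x : G ⧸ V), (s x)⁻¹ * (g * s (g⁻¹ • x)) ∈ V := by
    intro g x
    rw [← QuotientGroup.eq, hs]
    change x = ((g • Quotient.out (g⁻¹ • x) : G) : G ⧸ V)
    rw [MulAction.Quotient.coe_smul_out, smul_inv_smul]
  refine ⟨s, fun g x => ⟨(s x)⁻¹ * (g * s (g⁻¹ • x)), hmem g x⟩, hs, fun g x => rfl, ?_, ?_⟩
  · intro g h x
    apply Subtype.ext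
    simp only [Subgroup.coe_mul, mul_smul, mul_inv_rev]
    group
  · intro x
    apply Subtype.ext
    simp

/-- **S1 — the lifting property passes to finite-index subgroups** (finite shadow of "closed
subgroups of projective profinite groups are projective", Serre, *Galois Cohomology* I §3.4 / Shapiro):
if every homomorphism from `G` to a finite group lifts through every surjection of finite groups, the
same holds for every finite-index subgroup `V ≤ G`.  Proof: induce `π : V → P` to
`G → (G/V → P) ⋊ Sym(G/V)` via a transversal cocycle, lift through
`(G/V → E) ⋊ Sym(G/V) ↠ (G/V → P) ⋊ Sym(G/V)`, and read off the coordinate of the coset `V`, which `V`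
fixes. [folklore] -/
theorem stub_liftOfFiniteIndex {G : Type u} [Group G] (V : Subgroup G) [V.FiniteIndex]
    (hG : ∀ (P E : Type) [Group P] [Finite P] [Group E] [Finite E] (π : G →* P) (ε : E →* P),
      Function.Surjective ε → ∃ f : G →* E, ε.comp f = π)
    (P E : Type) [Group P] [Finite P] [Group E] [Finite E] (π : V →* P) (ε : E →* P)
    (hε : Function.Surjective ε) : ∃ f : V →* E, ε.comp f = π := by
  classical
  obtain ⟨s, d, hs, hd, hcoc, hd1⟩ := s1_exists_cocycle V
  -- the coset space `G ⧸ V` is finite; `G` permutes it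
  haveI : Finite (G ⧸ V) := Subgroup.finite_quotient_of_finiteIndex
  let τ : G →* Equiv.Perm (G ⧸ V) := MulAction.toPermHom G (G ⧸ V)
  have hτ : ∀ (g : G) (x : G ⧸ V), (τ g)⁻¹ • x = g⁻¹ • x := fun g x => by
    rw [Equiv.Perm.smul_def, Equiv.Perm.inv_def, MulAction.toPermHom_apply,
      MulAction.toPerm_symm_apply]
  -- the permutation wreath products `(G ⧸ V → P) ⋊ Sym (G ⧸ V)`, `(G ⧸ V → E) ⋊ Sym (G ⧸ V)`
  haveI : Finite (((G ⧸ V) → P) ⋊[mulAutArrow] Equiv.Perm (G ⧸ V)) :=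
    Finite.of_equiv _ SemidirectProduct.equivProd.symm
  haveI : Finite (((G ⧸ V) → E) ⋊[mulAutArrow] Equiv.Perm (G ⧸ V)) :=
    Finite.of_equiv _ SemidirectProduct.equivProd.symm
  -- the induced homomorphism `Φ : G → (G ⧸ V → P) ⋊ Sym (G ⧸ V)`
  obtain ⟨Φ, hΦl, hΦr⟩ : ∃ Φ : G →* ((G ⧸ V) → P) ⋊[mulAutArrow] Equiv.Perm (G ⧸ V),
      (∀ g x, (Φ g).left x = π (d g x)) ∧ (∀ g, (Φ g).right = τ g) := by
    refine ⟨{ toFun := fun g => ⟨fun x => π (d g x), τ g⟩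
              map_one' := ?_
              map_mul' := ?_ }, fun g x => rfl, fun g => rfl⟩
    · ext x
      · change π (d 1 x) = 1
        rw [hd1, map_one]
      · simp
    · intro g h
      ext x
      · change π (d (g * h) x) = π (d g x) * (mulAutArrow (τ g) (fun x => π (d h x))) x
        rw [hcoc, map_mul]
        change _ = π (d g x) * π (d h ((τ g)⁻¹ • x))
        rw [hτ]
      · simp
  -- the surjection `(G ⧸ V → E) ⋊ Sym ↠ (G ⧸ V → P) ⋊ Sym` induced by `ε`
  let εt : (((G ⧸ V) → E) ⋊[mulAutArrow] Equiv.Perm (G ⧸ V)) →*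
      (((G ⧸ V) → P) ⋊[mulAutArrow] Equiv.Perm (G ⧸ V)) :=
    SemidirectProduct.map (ε.compLeft (G ⧸ V)) (MonoidHom.id _) fun σ => by
      ext F x
      rfl
  have hεt : Function.Surjective εt := by
    intro w
    refine ⟨⟨fun x => Function.surjInv hε (w.left x), w.right⟩, ?_⟩
    ext x
    · simp [εt, Function.surjInv_eq hε]
    · simp [εt]
  -- lift `Φ` through it
  obtain ⟨F, hF⟩ := s1_lift_univ hG Φ εt hεt
  have hFr : ∀ g, (F g).right = τ g := fun g => by
    have := congrArg SemidirectProduct.right (DFunLike.congr_fun hF g)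
    simpa [εt, hΦr] using this
  have hFl : ∀ g x, ε ((F g).left x) = π (d g x) := fun g x => by
    have := congrArg
      (fun w : ((G ⧸ V) → P) ⋊[mulAutArrow] Equiv.Perm (G ⧸ V) => w.left x)
      (DFunLike.congr_fun hF g)
    simpa [εt, hΦl] using this
  -- the trivial coset `x₀` is fixed by `V`
  obtain ⟨x₀, hx₀⟩ : ∃ x₀ : G ⧸ V, x₀ = ((1 : G) : G ⧸ V) := ⟨_, rfl⟩
  have hfix : ∀ v : V, (v : G)⁻¹ • x₀ = x₀ := fun v => by
    rw [hx₀, MulAction.Quotient.smul_coe, QuotientGroup.eq]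
    simp
  -- reading off the coordinate `x₀` on `V` is a homomorphism `f₀ : V → E`
  obtain ⟨f₀, hf₀⟩ : ∃ f₀ : V →* E, ∀ v, f₀ v = (F v).left x₀ := by
    refine ⟨{ toFun := fun v => (F v).left x₀
              map_one' := by simp
              map_mul' := fun v w => ?_ }, fun v => rfl⟩
    rw [Subgroup.coe_mul, map_mul, SemidirectProduct.mul_left, Pi.mul_apply, hFr]
    change _ * (F w).left ((τ v)⁻¹ • x₀) = _
    rw [hτ, hfix]
  -- `s x₀ ∈ V`, and `ε ∘ f₀ = π ∘ conj (s x₀)⁻¹`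
  have hs₀ : s x₀ ∈ V := by
    have h : ((1 : G) : G ⧸ V) = (s x₀ : G ⧸ V) := by rw [hs, hx₀]
    rw [QuotientGroup.eq] at h
    simpa using h
  have hεf₀ : ∀ v : V, ε (f₀ v) = π (⟨s x₀, hs₀⟩⁻¹ * v * ⟨s x₀, hs₀⟩) := fun v => by
    rw [hf₀, hFl]
    congr 1
    apply Subtype.ext
    rw [hd, hfix]
    simp [mul_assoc]
  -- correct by the inner automorphism of `V` given by `s x₀`
  refine ⟨f₀.comp (MulAut.conj (⟨s x₀, hs₀⟩ : V)).toMonoidHom, MonoidHom.ext fun v => ?_⟩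
  rw [MonoidHom.comp_apply, MonoidHom.comp_apply, MulEquiv.coe_toMonoidHom, MulAut.conj_apply,
    hεf₀]
  congr 1
  group

end Summit.SmoothPoincare4.SmoothPoincare4.Theorems.HeegaardPairFreenessDetection.Sieve

end
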